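import Summits.QuantumFields.BalabanUV.T4Continuum.Support.GradedLineAveragingPairing
import Summits.QuantumFields.BalabanUV.T4Continuum.Support.GradedSubBlocksPoincare
import Summits.QuantumFields.BalabanUV.T4Continuum.Support.LineAveragingTwoLevelPairing
import Summits.QuantumFields.BalabanUV.T4Continuum.Support.GradedWellTwoLevel

/-!
# T⁴ programme, spine node NE2 (U1a), sub-row Δ1 «the graded well» — leaf (GW-E), summand (E4), PART 2b: THE SECOND PLANTED PAIRING
# IDENTITY AT AN ARBITRARY SUB-BLOCK SCALE `s`: `Q_s·Qavg_L = Q_{L·s}∘lift + D`, `‖D‖ ≤ 2·s⁻¹·(√((L·s)^d))⁻¹`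

NE2 formalisation swarm `b2b-balaban-t4-ne2-formalise-*`, LEAF PROVER 10 (gen 7); INTENT / CLAIM journal `CLAIMS.log` l.26596.  Owner rulings
R49 / R50 (l.25771 / l.26456): the graded-well END of record `GradedWellConsistencyTransfer.towerLimitRate_GW_of_laws` (leaf-06-g8, p246846)
displays the slot `hMc : ‖(Δ_a^{(k+1)})⁻¹·(M_{k+1}·J_k − J_k·M_k)·(Δ_a^{(k)})⁻¹‖ ≤ CM·θ^k` for the GRADED MASS `M_k = QvGWᴴ·QvGW` = summand
**(E4)** «the graded line-mass commutator» (PART 1 = leaf-03-g9's `GradedLineAveragingPairing.sqrt_smul_avgS_JK_apply` p246065, PART 2a =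
leaf-01-g11's `GradedLineAveragingBounds` p246734; remainder declared OPEN for any taker, l.26465).  E3's UNIT proof
(`LineAveragingMassCommutator.opNorm_JK_massComm_le`) needs TWO planted pairing identities; PART 1 is the scale-`s` twin of the first, THIS FILE
the scale-`s` twin of the SECOND (`LineAveragingTwoLevelPairing.opNorm_QvOp_mul_Qavg_sub_le`), on the owner's `GradedSubBlocks.avgS` (O16-a)
with the level-`k+1` rows indexed by the level-`k` anchors through the `cpt`-lift (the anchor part of the owner's `GradedWellTwoLevel.rowVLift`):
 * §1 **`liftA n L M s : Anc (fine n M) s ≃ Anc (fine (L·n) M) (L·s)`** (`cpt` / `par`), `liftAV` (× `Fin d`), and the scale-`s` twin of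
   `LineAveragingTwoLevel.bpt_glue`: **`site_lift_glue`** `site_{L·s} (lift z) (L·j + r) = cpt (site_s z j) + off r`;
 * §2 **`twoLevel_defect_apply_scale`** (pointwise, exact): `((Q_s·Qavg_L) g)(z,μ) − (Q_{L·s} g)(lift z, μ) = −(L·s)^{−(d+1)}·L⁻¹·Σ_{j,r,σ<L}
   [Σ_{i<σ} g(far end + i) − Σ_{i<σ} g(near end + i)]` by `LineAveragingTwoLevel.two_level_cancellation` at `n := s` VERBATIM (the `L`-strided
   scale-`s` contours from all `L^d` fine offsets cover the refined contour once; a window shift of `≤ L − 1` steps remains); its size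
   `norm_twoLevel_defect_apply_scale_le` is `L·(L·s)^{−(d+1)}·(S(z + s e_μ) + S(z))`, `S(w)` = the `ℓ¹`-mass of `g(·,μ)` on the refined sub-block;
 * §3 the DEFECT MATRIX `defectS := avgS_s * Qavg_L − (avgS_{L·s}).submatrix liftAV id` and **`opNorm_defectS_le (hs : s ∣ n) :
   ‖defectS‖ ≤ 2·s⁻¹·(√((L·s)^d))⁻¹`** (Cauchy–Schwarz over the two refined sub-blocks; the tilings `sum_sites_eq` ∘ `sum_tile'`).
 At `s = n` this is `opNorm_QvOp_mul_Qavg_sub_le` read on anchors.  PART 2c (`GradedLineMassCommutatorScale`) ports E3's §2 per scale with a row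
 weight; PART 2d (`GradedWellMassCommutator`) sums the layers of `QvGW` into the END `hMc`.

HONEST FRAMING (T4-DAG p. 1).  `U = 1`; finite torus; Bałaban's straight-contour averaging (1.18) at a sub-block scale and King's block averaging /
planting (2.10) as the tree types them; exact lattice identities and Cauchy–Schwarz only; statements, pairings and constants OURS ([folklore]; the
`[cite:]` tags locate printed OBJECTS — Bałaban and King print no such two-level identity); no two-level LAW of the cell is discharged here;
(E4) / `hMc` / the graded-well END OPEN; NE2 (U1a) NOT proved; spine PROVED 0/9 unchanged; NOT [B9] (3.16)/(3.23)–(3.27)/(3.42) as printed; NOT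
infinite volume, NOT a mass gap, NOT the Clay problem.  HONEST DEPENDENCY: continuum YM on T⁴ ⇐ BetaPertH ∧ nine spine estimates (0/9 proved);
BetaPertH ⇐ (D1) ∧ (D4) ∧ CAP+tail; G-an2-4 gates asym, D1 and NE2/3/4.  No `sorry`.
-/

noncomputable section

open scoped BigOperators ComplexConjugate Matrix Matrix.Norms.L2Operator
open Finset

namespace Summit.QuantumFields.BalabanUV.T4Continuum.GradedLineAveragingTwoLevel

open Literature.MathematicalPhysics.QuantumFieldTheory.Balaban1983to89.B5Prop11Plancherel (Tor fine unitVec)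
open Literature.MathematicalPhysics.QuantumFieldTheory.Balaban1983to89.B5Block118 (tstep tstep_zero tstep_succ)
open Literature.MathematicalPhysics.QuantumFieldTheory.Balaban1983to89.B5Composition116 (tstep_add)
open Literature.MathematicalPhysics.QuantumFieldTheory.Balaban1983to89.B5G183RateTorus (cpt)
open Literature.MathematicalPhysics.QuantumFieldTheory.Balaban1983to89.B5G183RateTorusW (off Qavg)
open Summit.QuantumFields.BalabanUV.T4Continuum
open Summit.QuantumFields.BalabanUV.T4Continuum.BalabanAveragedTowerModes (par val_par val_cpt_add_off)
open Summit.QuantumFields.BalabanUV.T4Continuum.CovariantBlockAveraging (opNorm_le_of_sq_le')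
open Summit.QuantumFields.BalabanUV.T4Continuum.LineAveragingPairing (glue glue_val sum_glue)
open Summit.QuantumFields.BalabanUV.T4Continuum.LineAveragingTwoLevel (Qavg_mulVec cpt_add_tstep off_update sum_sum_update sum_tile'
  sum_add_const two_level_cancellation)
open Summit.QuantumFields.BalabanUV.T4Continuum.GradedSubBlocks (Anchor Anc site site_add val_site avgS avgS_mulVec)
open Summit.QuantumFields.BalabanUV.T4Continuum.GradedSubBlocksPoincare (sum_sites_eq)
open Summit.QuantumFields.BalabanUV.T4Continuum.GradedWellTwoLevel (val_cpt' anchor_cpt par_cpt' cpt_par_of_dvd)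

variable {d : ℕ} (n L : ℕ) [NeZero n] [NeZero L] (M : Fin d → ℕ) [hM : ∀ μ, NeZero (M μ)] (s : ℕ) [NeZero s]

/-! ## §1 The `cpt`-lift of the scale-`s` anchors and the refined sub-block, cell by cell -/

omit [NeZero s] in
/-- a scale-`L·s` anchor of the refined torus has coordinates divisible by `L`, and its parent is a scale-`s` anchor. [folklore] -/
theorem anchor_par' {x : Tor (fine (L * n) M)} (hx : Anchor (fine (L * n) M) (L * s) x) :
    (∀ ν, L ∣ (x ν).val) ∧ Anchor (fine n M) s (par n L M x) := by
  refine ⟨fun ν => Dvd.dvd.trans (Dvd.intro _ rfl) (hx ν), fun ν => ?_⟩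
  obtain ⟨q, hq⟩ := hx ν
  rw [val_par, hq, mul_assoc, Nat.mul_div_cancel_left _ (Nat.pos_of_ne_zero (NeZero.ne L))]
  exact Dvd.intro _ rfl

/-- **THE LIFT OF THE SCALE-`s` ANCHORS** `z ↦ cpt z`: a bijection onto the scale-`L·s` anchors of the refined torus (inverse `par`) — the
anchor part of the owner's `GradedWellTwoLevel.rowVLift`. [cite: King1986, (2.10) p.653 (shape: the blocks B^k(y))] [folklore] -/
def liftA : Anc (fine n M) s ≃ Anc (fine (L * n) M) (L * s) where
  toFun z := ⟨cpt n L M z.1, anchor_cpt n L M z.2⟩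
  invFun x := ⟨par n L M x.1, (anchor_par' n L M s x.2).2⟩
  left_inv z := Subtype.ext (par_cpt' n L M z.1)
  right_inv x := Subtype.ext (cpt_par_of_dvd n L M (anchor_par' n L M s x.2).1)

omit [NeZero s] in
/-- the coordinate values of the lifted anchor: `(lift z)_ν = L·z_ν`. [folklore] -/
theorem val_liftA (z : Anc (fine n M) s) (ν : Fin d) : ((liftA n L M s z).1 ν).val = L * (z.1 ν).val :=
  val_cpt' n L M z.1 ν

/-- the lift on vector rows `(z, μ) ↦ (cpt z, μ)`. [folklore] -/
def liftAV : Anc (fine n M) s × Fin d ≃ Anc (fine (L * n) M) (L * s) × Fin d :=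
  (liftA n L M s).prodCongr (Equiv.refl (Fin d))

omit [NeZero s] in
/-- **THE REFINED SUB-BLOCK, CELL BY CELL** (scale-`s` twin of `LineAveragingTwoLevel.bpt_glue`): the site of offset `L·j + r` of the scale-`L·s`
sub-block of `cpt z` is the point of fine offset `r` in the `L`-cell of `site_s z j`. [cite: King1986, (2.10) p.653 (shape)] [folklore] -/
theorem site_lift_glue (hs : s ∣ n) (z : Anc (fine n M) s) (j : Fin d → Fin s) (r : Fin d → Fin L) :
    site (fine (L * n) M) (L * s) (liftA n L M s z).1 (glue s L (j, r)) = cpt n L M (site (fine n M) s z.1 j) + off n L M r := by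
  have hsn : ∀ ν, s ∣ fine n M ν := fun ν => Dvd.dvd.mul_right hs (M ν)
  have hLs : ∀ ν, L * s ∣ fine (L * n) M ν := fun ν => by
    show L * s ∣ L * n * M ν
    exact Dvd.dvd.mul_right (Nat.mul_dvd_mul_left L hs) (M ν)
  funext ν
  apply ZMod.val_injective
  rw [val_site _ _ hLs (liftA n L M s z).2 _ ν, val_liftA, glue_val, val_cpt_add_off, val_site _ _ hsn z.2 j ν]
  ring

/-! ## §2 The identity pointwise and its size -/

/-- the scale-`s` contours of King's block means, cell by cell: `L`-STRIDED refined contours. [folklore] -/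
theorem avgS_Qavg_mulVec (hs : s ∣ n) (g : Tor (fine (L * n) M) × Fin d → ℂ) (z : Anc (fine n M) s) (μ : Fin d) :
    ((avgS (fine n M) s * Qavg n L M) *ᵥ g) (z, μ)
      = ((s : ℂ) ^ (d + 1))⁻¹ * (((L : ℂ) ^ d)⁻¹ * ∑ j : Fin d → Fin s, ∑ r : Fin d → Fin L, ∑ t : Fin s,
          g (cpt n L M (site (fine n M) s z.1 j) + off n L M (Function.update r μ 0)
            + tstep (fine (L * n) M) μ ((r μ : ℕ) + L * t), μ)) := by
  have hsn : ∀ ν, s ∣ fine n M ν := fun ν => Dvd.dvd.mul_right hs (M ν)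
  rw [← Matrix.mulVec_mulVec, avgS_mulVec _ _ hsn]
  congr 1
  have e : ∀ (j : Fin d → Fin s) (t : Fin s), (Qavg n L M *ᵥ g) (site (fine n M) s z.1 j + tstep (fine n M) μ t, μ)
      = ((L : ℂ) ^ d)⁻¹ * ∑ r : Fin d → Fin L, g (cpt n L M (site (fine n M) s z.1 j) + off n L M (Function.update r μ 0)
            + tstep (fine (L * n) M) μ ((r μ : ℕ) + L * t), μ) := by
    intro j t
    rw [Qavg_mulVec]
    dsimp only
    congr 1
    refine sum_congr rfl fun r _ => ?_
    have hp : cpt n L M (site (fine n M) s z.1 j + tstep (fine n M) μ t) + off n L M r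
        = cpt n L M (site (fine n M) s z.1 j) + off n L M (Function.update r μ 0)
            + tstep (fine (L * n) M) μ ((r μ : ℕ) + L * t) := by
      conv_lhs => rw [← Function.update_eq_self μ r]
      rw [off_update, cpt_add_tstep, tstep_add]
      abel
    rw [hp]
  simp_rw [e]
  rw [Finset.mul_sum]
  refine sum_congr rfl fun j _ => ?_
  rw [← Finset.mul_sum, Finset.sum_comm]

/-- the scale-`L·s` contours of the lifted anchor, cell by cell: FULL refined contours from all fine offsets. [folklore] -/
theorem avgS_lift_mulVec (hs : s ∣ n) (g : Tor (fine (L * n) M) × Fin d → ℂ) (z : Anc (fine n M) s) (μ : Fin d) :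
    (avgS (fine (L * n) M) (L * s) *ᵥ g) (liftA n L M s z, μ)
      = ((((L * s : ℕ) : ℂ)) ^ (d + 1))⁻¹ * ∑ j : Fin d → Fin s, ∑ r : Fin d → Fin L, ∑ t' : Fin (L * s),
          g (cpt n L M (site (fine n M) s z.1 j) + off n L M (Function.update r μ 0)
            + tstep (fine (L * n) M) μ ((r μ : ℕ) + t'), μ) := by
  have hLs : ∀ ν, L * s ∣ fine (L * n) M ν := fun ν => by
    show L * s ∣ L * n * M ν
    exact Dvd.dvd.mul_right (Nat.mul_dvd_mul_left L hs) (M ν)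
  rw [avgS_mulVec _ _ hLs]
  push_cast
  congr 1
  rw [sum_glue s L (fun j' => ∑ t' : Fin (L * s), g (site (fine (L * n) M) (L * s) (liftA n L M s z).1 j'
    + tstep (fine (L * n) M) μ t', μ))]
  refine sum_congr rfl fun j _ => sum_congr rfl fun r _ => sum_congr rfl fun t' _ => ?_
  have hp : cpt n L M (site (fine n M) s z.1 j) + off n L M r + tstep (fine (L * n) M) μ t'
      = cpt n L M (site (fine n M) s z.1 j) + off n L M (Function.update r μ 0)
          + tstep (fine (L * n) M) μ ((r μ : ℕ) + t') := by
    conv_lhs => rw [← Function.update_eq_self μ r]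
    rw [off_update, tstep_add]
    abel
  rw [site_lift_glue n L M s hs, hp]

/-- **THE SECOND PAIRING IDENTITY AT SCALE `s`, POINTWISE** (exact; every `n, L, s ≥ 1`, `s ∣ n`, every torus, dimension): `((Q_s·Qavg_L) g)(z,μ)
− (Q_{L·s} g)(cpt z, μ)` is `(L·s)^{−(d+1)}·L⁻¹` times a sum over the sites `j` of the sub-block, the fine offsets `r` and `σ < L` of WINDOW SHIFTS
of `≤ L − 1` steps between the far end (`z + s e_μ`) and the near end (`LineAveragingTwoLevel.two_level_cancellation` at `n := s`).
[cite: Balaban1984PropagatorsI, (1.18) p.20; King1986, (2.10) p.653 (shapes)] [folklore] -/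
theorem twoLevel_defect_apply_scale (hs : s ∣ n) (g : Tor (fine (L * n) M) × Fin d → ℂ) (z : Anc (fine n M) s) (μ : Fin d) :
    ((avgS (fine n M) s * Qavg n L M) *ᵥ g) (z, μ) - (avgS (fine (L * n) M) (L * s) *ᵥ g) (liftA n L M s z, μ)
      = -((((((L * s : ℕ) : ℂ)) ^ (d + 1))⁻¹) * ((L : ℂ))⁻¹ *
          ∑ j : Fin d → Fin s, ∑ r : Fin d → Fin L, ∑ σ : Fin L,
            (∑ i ∈ range σ, g (cpt n L M (site (fine n M) s z.1 j) + off n L M (Function.update r μ 0)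
                + tstep (fine (L * n) M) μ (L * s + i), μ)
              - ∑ i ∈ range σ, g (cpt n L M (site (fine n M) s z.1 j) + off n L M (Function.update r μ 0)
                + tstep (fine (L * n) M) μ i, μ))) := by
  have hL : (L : ℂ) ≠ 0 := by exact_mod_cast NeZero.ne L
  have hsc : (s : ℂ) ≠ 0 := by exact_mod_cast NeZero.ne s
  rw [avgS_Qavg_mulVec n L M s hs, avgS_lift_mulVec n L M s hs]
  -- per site `j` of the sub-block, the cancellation
  have hcell : ∀ j : Fin d → Fin s,
      (L : ℂ) * ((L : ℂ) * ∑ r : Fin d → Fin L, ∑ t : Fin s,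
          g (cpt n L M (site (fine n M) s z.1 j) + off n L M (Function.update r μ 0)
            + tstep (fine (L * n) M) μ ((r μ : ℕ) + L * t), μ))
        - (L : ℂ) * ∑ r : Fin d → Fin L, ∑ t' : Fin (L * s),
          g (cpt n L M (site (fine n M) s z.1 j) + off n L M (Function.update r μ 0)
            + tstep (fine (L * n) M) μ ((r μ : ℕ) + t'), μ)
      = -∑ r : Fin d → Fin L, ∑ σ : Fin L,
            (∑ i ∈ range σ, g (cpt n L M (site (fine n M) s z.1 j) + off n L M (Function.update r μ 0)
                + tstep (fine (L * n) M) μ (L * s + i), μ)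
              - ∑ i ∈ range σ, g (cpt n L M (site (fine n M) s z.1 j) + off n L M (Function.update r μ 0)
                + tstep (fine (L * n) M) μ i, μ)) := fun j =>
    two_level_cancellation s L μ
      (G := fun r m => g (cpt n L M (site (fine n M) s z.1 j) + off n L M (Function.update r μ 0)
        + tstep (fine (L * n) M) μ m, μ))
      (fun r σ => by simp only [Function.update_idem])
  -- assemble: the prefactors `s^{−(d+1)}·L^{−d} = L·(L·s)^{−(d+1)}`
  have key : ∀ (A B D : (Fin d → Fin s) → ℂ), (∀ j, (L : ℂ) * ((L : ℂ) * A j) - (L : ℂ) * B j = -D j) →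
      ((s : ℂ) ^ (d + 1))⁻¹ * (((L : ℂ) ^ d)⁻¹ * ∑ j, A j) - ((((L * s : ℕ) : ℂ)) ^ (d + 1))⁻¹ * ∑ j, B j
        = -((((((L * s : ℕ) : ℂ)) ^ (d + 1))⁻¹) * ((L : ℂ))⁻¹ * ∑ j, D j) := by
    intro A B D h
    have h' : ∑ j, D j = -∑ j, ((L : ℂ) * ((L : ℂ) * A j) - (L : ℂ) * B j) := by
      rw [← sum_neg_distrib]; exact sum_congr rfl fun j _ => by rw [h j, neg_neg]
    rw [h', sum_sub_distrib, ← mul_sum, ← mul_sum, ← mul_sum]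
    push_cast
    field_simp
    ring
  exact key _ _ _ hcell

omit [NeZero L] in
/-- a window of `σ < L` terms is bounded by the full `L`-window of norms. [folklore] -/
theorem norm_window_le (F : ℕ → ℂ) (σ : Fin L) : ‖∑ i ∈ range σ, F i‖ ≤ ∑ i : Fin L, ‖F i‖ :=
  (norm_sum_le _ _).trans (by
    rw [Fin.sum_univ_eq_sum_range (fun i => ‖F i‖) L]
    exact sum_le_sum_of_subset_of_nonneg (range_subset_range.mpr σ.isLt.le) fun _ _ _ => norm_nonneg _)

/-- the pointwise SIZE of the defect: `‖((Q_s·Qavg_L) g)(z,μ) − (Q_{L·s} g)(cpt z, μ)‖ ≤ L·(L·s)^{−(d+1)}·(S(z + s e_μ) + S(z))`, `S(w)` = the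
`ℓ¹`-mass of `g(·, μ)` on the refined sub-block of the anchor `w` (its `s^d` `L`-cells). [folklore] -/
theorem norm_twoLevel_defect_apply_scale_le (hs : s ∣ n) (g : Tor (fine (L * n) M) × Fin d → ℂ) (z : Anc (fine n M) s) (μ : Fin d) :
    ‖((avgS (fine n M) s * Qavg n L M) *ᵥ g) (z, μ) - (avgS (fine (L * n) M) (L * s) *ᵥ g) (liftA n L M s z, μ)‖
      ≤ (L : ℝ) * ((((L * s : ℕ) : ℝ)) ^ (d + 1))⁻¹ *
          (∑ j : Fin d → Fin s, ∑ r : Fin d → Fin L, ‖g (cpt n L M (site (fine n M) s (z.1 + tstep (fine n M) μ s) j) + off n L M r, μ)‖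
            + ∑ j : Fin d → Fin s, ∑ r : Fin d → Fin L, ‖g (cpt n L M (site (fine n M) s z.1 j) + off n L M r, μ)‖) := by
  have hL0 : (0 : ℝ) < L := by exact_mod_cast Nat.pos_of_ne_zero (NeZero.ne L)
  rw [twoLevel_defect_apply_scale n L M s hs, norm_neg, norm_mul, norm_mul]
  have hc1 : ‖(((((L * s : ℕ) : ℂ)) ^ (d + 1))⁻¹)‖ = ((((L * s : ℕ) : ℝ)) ^ (d + 1))⁻¹ := by
    rw [norm_inv, norm_pow, Complex.norm_natCast]
  have hc2 : ‖((L : ℂ))⁻¹‖ = (L : ℝ)⁻¹ := by rw [norm_inv, Complex.norm_natCast]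
  rw [hc1, hc2]
  -- the far and near window points are cell points of the refined sub-blocks of `z + s e_μ` and `z`
  have hfar : ∀ (j : Fin d → Fin s) (r : Fin d → Fin L) (i : Fin L),
      cpt n L M (site (fine n M) s z.1 j) + off n L M (Function.update r μ 0) + tstep (fine (L * n) M) μ (L * s + i)
        = cpt n L M (site (fine n M) s (z.1 + tstep (fine n M) μ s) j) + off n L M (Function.update r μ i) := by
    intro j r i
    rw [site_add, cpt_add_tstep, off_update n L M r μ i, tstep_add]
    abel
  have hnear : ∀ (j : Fin d → Fin s) (r : Fin d → Fin L) (i : Fin L),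
      cpt n L M (site (fine n M) s z.1 j) + off n L M (Function.update r μ 0) + tstep (fine (L * n) M) μ i
        = cpt n L M (site (fine n M) s z.1 j) + off n L M (Function.update r μ i) := by
    intro j r i
    rw [off_update n L M r μ i, add_assoc]
  -- bound the window sums by full `L`-windows
  have hwin : ∀ (j : Fin d → Fin s) (r : Fin d → Fin L) (σ : Fin L),
      ‖∑ i ∈ range σ, g (cpt n L M (site (fine n M) s z.1 j) + off n L M (Function.update r μ 0)
            + tstep (fine (L * n) M) μ (L * s + i), μ)
          - ∑ i ∈ range σ, g (cpt n L M (site (fine n M) s z.1 j) + off n L M (Function.update r μ 0)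
            + tstep (fine (L * n) M) μ i, μ)‖
        ≤ ∑ i : Fin L, ‖g (cpt n L M (site (fine n M) s (z.1 + tstep (fine n M) μ s) j) + off n L M (Function.update r μ i), μ)‖
          + ∑ i : Fin L, ‖g (cpt n L M (site (fine n M) s z.1 j) + off n L M (Function.update r μ i), μ)‖ := by
    intro j r σ
    refine (norm_sub_le _ _).trans (add_le_add ((norm_window_le L _ σ).trans (le_of_eq (sum_congr rfl fun i _ => by rw [hfar])))
      ((norm_window_le L _ σ).trans (le_of_eq (sum_congr rfl fun i _ => by rw [hnear]))))
  have hsum : ‖∑ j : Fin d → Fin s, ∑ r : Fin d → Fin L, ∑ σ : Fin L,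
        (∑ i ∈ range σ, g (cpt n L M (site (fine n M) s z.1 j) + off n L M (Function.update r μ 0)
            + tstep (fine (L * n) M) μ (L * s + i), μ)
          - ∑ i ∈ range σ, g (cpt n L M (site (fine n M) s z.1 j) + off n L M (Function.update r μ 0)
            + tstep (fine (L * n) M) μ i, μ))‖
      ≤ (L : ℝ) * ((L : ℝ) *
          (∑ j : Fin d → Fin s, ∑ r : Fin d → Fin L,
              ‖g (cpt n L M (site (fine n M) s (z.1 + tstep (fine n M) μ s) j) + off n L M r, μ)‖
            + ∑ j : Fin d → Fin s, ∑ r : Fin d → Fin L, ‖g (cpt n L M (site (fine n M) s z.1 j) + off n L M r, μ)‖)) := by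
    refine (norm_sum_le _ _).trans ?_
    refine (sum_le_sum fun j _ => (norm_sum_le _ _).trans (sum_le_sum fun r _ =>
      (norm_sum_le _ _).trans (sum_le_sum fun σ _ => hwin j r σ))).trans (le_of_eq ?_)
    simp only [sum_const, card_univ, Fintype.card_fin, nsmul_eq_mul]
    have h1 : ∀ j : Fin d → Fin s,
        ∑ r : Fin d → Fin L,
          (∑ i : Fin L, ‖g (cpt n L M (site (fine n M) s (z.1 + tstep (fine n M) μ s) j) + off n L M (Function.update r μ i), μ)‖
            + ∑ i : Fin L, ‖g (cpt n L M (site (fine n M) s z.1 j) + off n L M (Function.update r μ i), μ)‖)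
          = (L : ℝ) * (∑ r : Fin d → Fin L, ‖g (cpt n L M (site (fine n M) s (z.1 + tstep (fine n M) μ s) j) + off n L M r, μ)‖
            + ∑ r : Fin d → Fin L, ‖g (cpt n L M (site (fine n M) s z.1 j) + off n L M r, μ)‖) := by
      intro j
      rw [sum_add_distrib,
        sum_sum_update L μ (fun r => ‖g (cpt n L M (site (fine n M) s (z.1 + tstep (fine n M) μ s) j) + off n L M r, μ)‖),
        sum_sum_update L μ (fun r => ‖g (cpt n L M (site (fine n M) s z.1 j) + off n L M r, μ)‖), nsmul_eq_mul, nsmul_eq_mul, mul_add]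
    simp_rw [← mul_sum]
    simp_rw [h1]
    rw [← mul_sum, sum_add_distrib]
  refine (mul_le_mul_of_nonneg_left hsum (by positivity)).trans (le_of_eq ?_)
  field_simp

/-! ## §3 The defect matrix and its operator norm -/

/-- **THE SECOND-PAIRING DEFECT AT SCALE `s`**: `D := Q_s·Qavg_L − Q_{L·s}∘lift` (rows = scale-`s` anchors × directions of the level-`k`
torus, columns = bonds of the level-`k+1` torus). [folklore] -/
def defectS : Matrix (Anc (fine n M) s × Fin d) (Tor (fine (L * n) M) × Fin d) ℂ :=
  avgS (fine n M) s * Qavg n L M - (avgS (fine (L * n) M) (L * s)).submatrix (liftAV n L M s) id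

omit [NeZero s] in
/-- the defect acts by the pointwise difference of §2. [folklore] -/
theorem defectS_mulVec (g : Tor (fine (L * n) M) × Fin d → ℂ) (z : Anc (fine n M) s) (μ : Fin d) :
    (defectS n L M s *ᵥ g) (z, μ)
      = ((avgS (fine n M) s * Qavg n L M) *ᵥ g) (z, μ) - (avgS (fine (L * n) M) (L * s) *ᵥ g) (liftA n L M s z, μ) := by
  unfold defectS
  rw [Matrix.sub_mulVec, Pi.sub_apply]
  rfl

/-- **`Q_s·Qavg_L = Q_{L·s}∘lift + D` WITH `‖D‖ ≤ 2·s⁻¹·(√((L·s)^d))⁻¹`**: Bałaban's scale-`s` (1.18) average of King's `L`-block means is the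
scale-`L·s` average of the refined torus (rows lifted by `cpt`) up to an OPERATOR-NORM defect of relative size `s⁻¹`; no regularity of the field.
(Scale-`s` twin of `LineAveragingTwoLevelPairing.opNorm_QvOp_mul_Qavg_sub_le`; companion of `GradedLineAveragingPairing.sqrt_smul_avgS_JK_apply`;
statement and proof OURS.) [cite: Balaban1984PropagatorsI, (1.18) p.20; King1986, (2.10) p.653 (shapes)] [folklore] -/
theorem opNorm_defectS_le (hs : s ∣ n) :
    ‖defectS n L M s‖ ≤ 2 * ((s : ℝ))⁻¹ * (Real.sqrt ((((L * s : ℕ) : ℝ)) ^ d))⁻¹ := by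
  have hs0 : (0 : ℝ) < s := by exact_mod_cast Nat.pos_of_ne_zero (NeZero.ne s)
  have hL : (0 : ℝ) < L := by exact_mod_cast Nat.pos_of_ne_zero (NeZero.ne L)
  have hLs : (0 : ℝ) < ((L * s : ℕ) : ℝ) := by push_cast; positivity
  have hLsd : (0 : ℝ) < (((L * s : ℕ) : ℝ)) ^ d := pow_pos hLs d
  have hsn : ∀ ν, s ∣ fine n M ν := fun ν => Dvd.dvd.mul_right hs (M ν)
  set X := defectS n L M s with hX
  refine opNorm_le_of_sq_le' X (by positivity) fun g => ?_
  have e0 : ∑ b, ‖∑ i, X b i * g i‖ ^ 2 = ∑ b, ‖(X *ᵥ g) b‖ ^ 2 := rfl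
  rw [e0, Fintype.sum_prod_type]
  simp only [hX, defectS_mulVec]
  set c : ℝ := (L : ℝ) * ((((L * s : ℕ) : ℝ)) ^ (d + 1))⁻¹ with hc
  set S : Tor (fine n M) → Fin d → ℝ := fun w μ =>
    ∑ j : Fin d → Fin s, ∑ r : Fin d → Fin L, ‖g (cpt n L M (site (fine n M) s w j) + off n L M r, μ)‖ with hS
  set S2 : Tor (fine n M) → Fin d → ℝ := fun w μ =>
    ∑ j : Fin d → Fin s, ∑ r : Fin d → Fin L, ‖g (cpt n L M (site (fine n M) s w j) + off n L M r, μ)‖ ^ 2 with hS2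
  have hN2 : ∀ (w : Tor (fine n M)) (μ : Fin d), (S w μ) ^ 2 ≤ ((((L * s : ℕ) : ℝ)) ^ d) * S2 w μ := by
    intro w μ
    have h1 : (S w μ) ^ 2
        ≤ (s : ℝ) ^ d * ∑ j : Fin d → Fin s, (∑ r : Fin d → Fin L, ‖g (cpt n L M (site (fine n M) s w j) + off n L M r, μ)‖) ^ 2 := by
      have := sq_sum_le_card_mul_sum_sq (s := (univ : Finset (Fin d → Fin s)))
        (f := fun j => ∑ r : Fin d → Fin L, ‖g (cpt n L M (site (fine n M) s w j) + off n L M r, μ)‖)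
      simp only [card_univ, Fintype.card_fun, Fintype.card_fin] at this
      push_cast at this
      exact this
    have h2 : ∀ j : Fin d → Fin s, (∑ r : Fin d → Fin L, ‖g (cpt n L M (site (fine n M) s w j) + off n L M r, μ)‖) ^ 2
        ≤ (L : ℝ) ^ d * ∑ r : Fin d → Fin L, ‖g (cpt n L M (site (fine n M) s w j) + off n L M r, μ)‖ ^ 2 := by
      intro j
      have := sq_sum_le_card_mul_sum_sq (s := (univ : Finset (Fin d → Fin L)))
        (f := fun r => ‖g (cpt n L M (site (fine n M) s w j) + off n L M r, μ)‖)
      simp only [card_univ, Fintype.card_fun, Fintype.card_fin] at this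
      push_cast at this
      exact this
    refine h1.trans ?_
    have h3 : (s : ℝ) ^ d * ∑ j : Fin d → Fin s, (∑ r : Fin d → Fin L, ‖g (cpt n L M (site (fine n M) s w j) + off n L M r, μ)‖) ^ 2
        ≤ (s : ℝ) ^ d * ∑ j : Fin d → Fin s, ((L : ℝ) ^ d
            * ∑ r : Fin d → Fin L, ‖g (cpt n L M (site (fine n M) s w j) + off n L M r, μ)‖ ^ 2) :=
      mul_le_mul_of_nonneg_left (sum_le_sum fun j _ => h2 j) (by positivity)
    refine h3.trans (le_of_eq ?_)
    rw [← mul_sum, ← mul_assoc, ← mul_pow]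
    push_cast
    ring
  have hterm : ∀ (z : Anc (fine n M) s) (μ : Fin d),
      ‖((avgS (fine n M) s * Qavg n L M) *ᵥ g) (z, μ) - (avgS (fine (L * n) M) (L * s) *ᵥ g) (liftA n L M s z, μ)‖ ^ 2
        ≤ c ^ 2 * (2 * (((((L * s : ℕ) : ℝ)) ^ d) * (S2 (z.1 + tstep (fine n M) μ s) μ + S2 z.1 μ))) := by
    intro z μ
    have h := norm_twoLevel_defect_apply_scale_le n L M s hs g z μ
    rw [← hc] at h
    have hc0 : 0 ≤ c := by rw [hc]; positivity
    have hsq : ‖((avgS (fine n M) s * Qavg n L M) *ᵥ g) (z, μ) - (avgS (fine (L * n) M) (L * s) *ᵥ g) (liftA n L M s z, μ)‖ ^ 2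
        ≤ (c * (S (z.1 + tstep (fine n M) μ s) μ + S z.1 μ)) ^ 2 := pow_le_pow_left₀ (norm_nonneg _) h 2
    refine hsq.trans ?_
    rw [mul_pow]
    refine mul_le_mul_of_nonneg_left ?_ (sq_nonneg _)
    have h12 : (S (z.1 + tstep (fine n M) μ s) μ + S z.1 μ) ^ 2 ≤ 2 * ((S (z.1 + tstep (fine n M) μ s) μ) ^ 2 + (S z.1 μ) ^ 2) := by
      nlinarith [sq_nonneg (S (z.1 + tstep (fine n M) μ s) μ - S z.1 μ)]
    refine h12.trans ?_
    rw [mul_add ((((L * s : ℕ) : ℝ)) ^ d)]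
    exact mul_le_mul_of_nonneg_left (add_le_add (hN2 _ μ) (hN2 z.1 μ)) (by norm_num)
  refine (sum_le_sum fun z _ => sum_le_sum fun μ _ => hterm z μ).trans ?_
  have hSB : ∑ z : Anc (fine n M) s, ∑ μ : Fin d, S2 z.1 μ = ∑ i, ‖g i‖ ^ 2 := by
    calc ∑ z : Anc (fine n M) s, ∑ μ : Fin d, S2 z.1 μ
        = ∑ μ : Fin d, ∑ z : Anc (fine n M) s, S2 z.1 μ := sum_comm
      _ = ∑ μ : Fin d, ∑ x' : Tor (fine (L * n) M), ‖g (x', μ)‖ ^ 2 := by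
          refine sum_congr rfl fun μ _ => ?_
          rw [← sum_sites_eq (fine n M) s hsn (fun w => ∑ r : Fin d → Fin L, ‖g (cpt n L M w + off n L M r, μ)‖ ^ 2),
            ← sum_tile' n L M (fun x' => ‖g (x', μ)‖ ^ 2)]
      _ = ∑ x' : Tor (fine (L * n) M), ∑ μ : Fin d, ‖g (x', μ)‖ ^ 2 := sum_comm
      _ = ∑ i, ‖g i‖ ^ 2 := by rw [Fintype.sum_prod_type]
  have hSA : ∑ z : Anc (fine n M) s, ∑ μ : Fin d, S2 (z.1 + tstep (fine n M) μ s) μ = ∑ i, ‖g i‖ ^ 2 := by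
    calc ∑ z : Anc (fine n M) s, ∑ μ : Fin d, S2 (z.1 + tstep (fine n M) μ s) μ
        = ∑ μ : Fin d, ∑ z : Anc (fine n M) s, S2 (z.1 + tstep (fine n M) μ s) μ := sum_comm
      _ = ∑ μ : Fin d, ∑ x' : Tor (fine (L * n) M), ‖g (x', μ)‖ ^ 2 := by
          refine sum_congr rfl fun μ _ => ?_
          have e2 : ∀ z : Anc (fine n M) s, S2 (z.1 + tstep (fine n M) μ s) μ
              = ∑ j : Fin d → Fin s, ∑ r : Fin d → Fin L,
                  ‖g (cpt n L M (site (fine n M) s z.1 j + tstep (fine n M) μ s) + off n L M r, μ)‖ ^ 2 := by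
            intro z
            simp only [hS2, site_add]
          simp_rw [e2]
          rw [← sum_sites_eq (fine n M) s hsn
              (fun w => ∑ r : Fin d → Fin L, ‖g (cpt n L M (w + tstep (fine n M) μ s) + off n L M r, μ)‖ ^ 2),
            sum_add_const n M (fun w => ∑ r : Fin d → Fin L, ‖g (cpt n L M w + off n L M r, μ)‖ ^ 2),
            ← sum_tile' n L M (fun x' => ‖g (x', μ)‖ ^ 2)]
      _ = ∑ x' : Tor (fine (L * n) M), ∑ μ : Fin d, ‖g (x', μ)‖ ^ 2 := sum_comm
      _ = ∑ i, ‖g i‖ ^ 2 := by rw [Fintype.sum_prod_type]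
  have htot : ∑ z : Anc (fine n M) s, ∑ μ : Fin d,
        c ^ 2 * (2 * (((((L * s : ℕ) : ℝ)) ^ d) * (S2 (z.1 + tstep (fine n M) μ s) μ + S2 z.1 μ)))
      = c ^ 2 * (2 * (((((L * s : ℕ) : ℝ)) ^ d) * (∑ i, ‖g i‖ ^ 2 + ∑ i, ‖g i‖ ^ 2))) := by
    simp_rw [← mul_sum]
    simp_rw [sum_add_distrib]
    rw [hSA, hSB]
  rw [htot, hc, mul_pow, mul_pow, inv_pow (Real.sqrt _), Real.sq_sqrt hLsd.le]
  have hs1 : (s : ℝ) ≠ 0 := hs0.ne'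
  have hL1 : (L : ℝ) ≠ 0 := hL.ne'
  apply le_of_eq
  push_cast
  field_simp
  ring

end Summit.QuantumFields.BalabanUV.T4Continuum.GradedLineAveragingTwoLevel

end
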